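import Mathlib.GroupTheory.QuotientGroup.Finite
import Literature.Probability.LatticeModels.GinibreInequality
import Literature.Probability.LatticeModels.GinibreCovariance
import HarnessLib

/-!
# Ginibre's inequality for finite abelian groups with even torsion
# (Ginibre 1970, Example 4, the discrete case: cyclic groups `ℤ_p` of ANY order `p`)

J. Ginibre, *General formulation of Griffiths' inequalities*, Comm. Math. Phys. **16** (1970)
310–328 [Ginibre1970], §2 Example 4 (held text `paper:ginibre1970-general-formulation-griffiths-inequalities`,
p. 316–317): «We take `G` commutative, `σ` is the Haar measure on `G` and `Q(S)` is the set of all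
real positive definite functions on `G`. We moreover restrict our attention to the case where `G` is
the direct product of a finite number of circles `T₁` and a finite number of finite cyclic groups
`ℤ_{pᵢ}` … The functions in `S` are the functions `f_m(θ) = cos(m·θ)` … We now show that `S`
satisfies (Q3)»; and, for the change of variables `α = (θ'+θ)/2`, `β = (θ'−θ)/2` in the discrete
case (p. 317): «In the discrete case where `θ` and `θ'` represent elements in a finite cyclic group
`ℤ_p`, one has to consider separately the two subdomains that consist of points with both `α` and
`β` even multiples or odd multiples of `π/p`. Each subdomain is the product of identical domains for
the variables `α` and `β` … Finally, `J` reduces to one term, or to a sum of terms, of the type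
`∫ dω F(ω) [∫ dα ∏ cos(mᵢα) ∏ sin(mᵢα)]²`. This is positive, and (Q3) is proved.»

The tree's `ginibreExpect_reChar_mono` (`GinibreInequality.lean`) proves Griffiths' second
inequality in Ginibre's monotone form for every compact abelian group **in which every element is a
square** (tori `U(1)^E`, odd cyclic groups): its change of variables is the duplication map
`(φ,ψ) ↦ (φψ, φψ⁻¹)`, which is onto only for 2-divisible groups. This file adds the printed DISCRETE
case with even torsion — `ℤ_p` for every `p`, products `∏ ℤ_{pₑ}`, the `ℤ_n` clock models and
`ℤ_n` lattice gauge theories for EVEN `n` — by Ginibre's parity decomposition, in the following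
abstract form.

**Square-root extensions.** Let `Ω` be a finite abelian group, `j : Ω → Ω̃` an injective
homomorphism into a finite abelian group `Ω̃` such that every `j(ω)` is a square in `Ω̃`
(`ℤ_p ↪ ℤ_{2p}`: every `p`-th root of unity is the square of a `2p`-th root of unity; coordinatewise
for products), and let the interaction characters of the model on `Ω` be restrictions `χ̃ₐ ∘ j` of
characters of `Ω̃` (for `ℤ_p ↪ ℤ_{2p}` every character of `ℤ_p` is such a restriction). Then for
the Haar (= uniform) probability measure `μ` on `Ω` and couplings `0 ≤ J ≤ J'`:
`⟨Re χ̃₀∘j⟩_J ≤ ⟨Re χ̃₀∘j⟩_{J'}` (`ginibreExpect_reChar_mono_of_sqrtExt`).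

**Proof (Ginibre's, made coset-free).** With `H = {(φ,ψ) ∈ Ω̃² : φψ ∈ jΩ, φψ⁻¹ ∈ jΩ}` — the
preimage of `jΩ × jΩ` under the duplication map `D(φ,ψ) = (φψ, φψ⁻¹)` — the square-root hypothesis
makes `D : H → jΩ × jΩ` onto with fibres of the constant size `#ker D`, so
`∑_{θ,θ' ∈ Ω} F(jθ, jθ') = (#ker D)⁻¹ ∑_{(φ,ψ) ∈ H} F(φψ, φψ⁻¹)` (`sum_comp_eq_sum_dupPreimage`).
In the quotient `Ω̃/jΩ` the set `H` reads `{π φ = π ψ, (π φ)² = 1}`: it is the disjoint union over the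
2-torsion classes `q` of the PRODUCT sets `π⁻¹(q) × π⁻¹(q)` (the printed «both even / both odd»
subdomains), and on a product set `D × D` a positive kernel `∑ᵢ cᵢ Gᵢ(φ)Gᵢ(ψ)` sums to
`∑ᵢ cᵢ (∑_D Gᵢ)² ≥ 0` (`sum_fibreBlocks_nonneg_of_isPosKernel`). The rest is the tree's Ginibre
machinery verbatim (`integral_sub_mul_sub_mul`, `ginibre_key`, the truncations `ginibreTrunc` of the
duplicated integrand, which are positive kernels).

**Instances.** The theorem is stated for an abstract finite `Ω` with characters `χₐ = χ̃ₐ ∘ j`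
(hypotheses `hχ`, `hχ₀`); `exists_mul_self_eq_compLeft` supplies the square-root hypothesis for
configuration groups `E → Γ` from a coordinatewise one `Γ ↪ Γ̃` (e.g. `Γ = ℤ_n ⊂ Γ̃ = ℤ_{2n} ⊂ U(1)`,
all `n`), the shape of the tree's `ℤ_n` lattice gauge configurations
`GaugeConfig d L (rootsOfUnityCircle n)`; the torus Wilson-loop monotonicity for every `n` is derived
from it in `Literature.MathematicalPhysics.QuantumFieldTheory.ZnWilsonLoopMonotone`.

§5–§6 add Griffiths' FIRST inequality through the extension (`ginibreExpect_reChar_nonneg_of_sqrtExt`,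
from the second one and the free system) and the COVARIANCE form
`ginibreExpect_mul_reChar_ge_of_sqrtExt` (`⟨Re χ₀⟩⟨Re χ₁⟩ ≤ ⟨Re χ₀ Re χ₁⟩`, the tree's
`ginibreExpect_mul_reChar_ge` without the squares hypothesis, for finite groups).

Scope / TODO(general form): Ginibre's mixed products (circles × even cyclic groups) need the same
parity decomposition with a Haar integral over the circle factors; not typed here (the 2-divisible
factors alone are `ginibreExpect_reChar_mono`). HONEST LABEL: a finite-volume correlation
inequality; nothing here bears on the Yang–Mills mass gap.

## References

* J. Ginibre, Comm. Math. Phys. 16 (1970) 310–328, §2 Example 4 and the discrete change of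
  variables p. 316–317, Fig. 2 (`G = ℤ₂`). [Ginibre1970]
* R. B. Griffiths, J. Math. Phys. 8 (1967) 478, 484 (the Ising case). [Griffiths1967]
-/

noncomputable section

open MeasureTheory Filter Finset
open scoped Topology BigOperators

namespace Literature.Probability.LatticeModels

namespace GinibreSqrtExt

/-! ### 1. Positive kernels summed over fibre blocks -/

section Blocks

variable {Ωt : Type*} [TopologicalSpace Ωt] [Fintype Ωt] {Q : Type*} [DecidableEq Q]

omit [Fintype Ωt] in
/-- On a product block `D × D` a positive kernel has a non-negative sum:
`∑_{φ∈D} ∑_{ψ∈D} ∑ᵢ cᵢ Gᵢ(φ) Gᵢ(ψ) = ∑ᵢ cᵢ (∑_D Gᵢ)² ≥ 0` — the printed «product of identical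
domains for the variables `α` and `β`». [cite: Ginibre1970, §2 Example 4 (discrete case, p. 317)] -/
theorem sum_block_nonneg_of_isPosKernel {k : Ωt × Ωt → ℝ} (hk : IsPosKernel k) (D : Finset Ωt) :
    0 ≤ ∑ φ ∈ D, ∑ ψ ∈ D, k (φ, ψ) := by
  obtain ⟨κ, _, c, G, hc, -, rfl⟩ := hk
  have h : ∑ i, c i * ((∑ φ ∈ D, G i φ) * (∑ ψ ∈ D, G i ψ)) =
      ∑ φ ∈ D, ∑ ψ ∈ D, ∑ i, c i * (G i (φ, ψ).1 * G i (φ, ψ).2) := by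
    have h1 : ∀ i, c i * ((∑ φ ∈ D, G i φ) * (∑ ψ ∈ D, G i ψ)) =
        ∑ φ ∈ D, ∑ ψ ∈ D, c i * (G i φ * G i ψ) := fun i => by
      rw [Finset.sum_mul_sum, Finset.mul_sum]
      refine Finset.sum_congr rfl fun φ _ => ?_
      rw [Finset.mul_sum]
    simp_rw [h1]
    rw [Finset.sum_comm]
    refine Finset.sum_congr rfl fun φ _ => ?_
    rw [Finset.sum_comm]
  rw [← h]
  exact Finset.sum_nonneg fun i _ => mul_nonneg (hc i) (mul_self_nonneg _)

/-- **The parity decomposition**: for any map `π : Ω̃ → Q` and any set `P` of classes, the set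
`{(φ,ψ) : π φ = π ψ ∈ P}` is the disjoint union of the blocks `π⁻¹(q) × π⁻¹(q)`, `q ∈ P`, so a
positive kernel has a non-negative sum over it. [cite: Ginibre1970, §2 Example 4 (discrete case, p. 317)] -/
theorem sum_fibreBlocks_nonneg_of_isPosKernel {k : Ωt × Ωt → ℝ} (hk : IsPosKernel k) (π : Ωt → Q)
    (P : Finset Q) :
    0 ≤ ∑ p ∈ (Finset.univ : Finset (Ωt × Ωt)).filter (fun p => π p.1 = π p.2 ∧ π p.1 ∈ P), k p := by
  classical
  have hset : (Finset.univ : Finset (Ωt × Ωt)).filter (fun p => π p.1 = π p.2 ∧ π p.1 ∈ P) =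
      P.biUnion (fun q => (Finset.univ.filter (fun φ => π φ = q)) ×ˢ
        (Finset.univ.filter (fun φ => π φ = q))) := by
    ext p
    simp only [Finset.mem_filter, Finset.mem_univ, true_and, Finset.mem_biUnion, Finset.mem_product]
    constructor
    · rintro ⟨h1, h2⟩; exact ⟨π p.1, h2, rfl, h1.symm⟩
    · rintro ⟨q, hq, h1, h2⟩; exact ⟨h1.trans h2.symm, h1 ▸ hq⟩
  rw [hset, Finset.sum_biUnion]
  · refine Finset.sum_nonneg fun q _ => ?_
    rw [Finset.sum_product]
    exact sum_block_nonneg_of_isPosKernel hk _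
  · intro q _ q' _ hqq'
    simp only [Function.onFun]
    rw [Finset.disjoint_left]
    rintro ⟨φ, ψ⟩ h h'
    simp only [Finset.mem_product, Finset.mem_filter, Finset.mem_univ, true_and] at h h'
    exact hqq' (h.1.symm.trans h'.1)

end Blocks

/-! ### 2. The duplicated Ginibre integrand summed over the parity blocks is non-negative -/

section Integrand

variable {Ωt : Type*} [CommGroup Ωt] [TopologicalSpace Ωt] [Fintype Ωt] {Q : Type*}
  [DecidableEq Q] {ι : Type*} [Fintype ι]

/-- The Ginibre integrand `4 Im χ₀ Im χ₀ sinh B exp C` has a non-negative sum over every union of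
fibre blocks: its truncations are positive kernels (`isPosKernel_ginibreTrunc`) and converge
pointwise. [cite: Ginibre1970, §2 Example 4 (discrete case, p. 317)] -/
theorem sum_fibreBlocks_ginibreIntegrand_nonneg (χ : ι → Ωt →ₜ* Circle) (χ₀ : Ωt →ₜ* Circle)
    {δ γ : ι → ℝ} (hδ : ∀ a, 0 ≤ δ a) (hγ : ∀ a, 0 ≤ γ a) (π : Ωt → Q) (P : Finset Q) :
    0 ≤ ∑ p ∈ (Finset.univ : Finset (Ωt × Ωt)).filter (fun p => π p.1 = π p.2 ∧ π p.1 ∈ P),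
      ginibreIntegrand χ χ₀ δ γ p := by
  set S := (Finset.univ : Finset (Ωt × Ωt)).filter (fun p => π p.1 = π p.2 ∧ π p.1 ∈ P) with hS
  have hlim : Tendsto (fun N => ∑ p ∈ S, ginibreTrunc χ χ₀ δ γ N p) atTop
      (𝓝 (∑ p ∈ S, ginibreIntegrand χ χ₀ δ γ p)) :=
    tendsto_finsetSum _ fun p _ => tendsto_ginibreTrunc χ χ₀ δ γ p
  exact ge_of_tendsto' hlim fun N =>
    sum_fibreBlocks_nonneg_of_isPosKernel (isPosKernel_ginibreTrunc χ χ₀ hδ hγ N) π P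

end Integrand

/-! ### 3. The change of variables through a square-root extension -/

section ChangeOfVariables

variable {Ω Ωt : Type*} [CommGroup Ω] [Fintype Ω] [CommGroup Ωt] [Fintype Ωt] [DecidableEq Ωt]

/-- **Fibres of the duplication map over squares have the size of its kernel.** If `y = D p₀` then
`{p : D p = y} = p₀ · ker D`. [cite: Ginibre1970, §2 Example 4 (discrete change of variables, p. 317)] -/
theorem card_filter_dupHom_eq (p₀ : Ωt × Ωt) :
    (Finset.univ.filter fun p : Ωt × Ωt => dupHom p = dupHom p₀).card =
      (Finset.univ.filter fun p : Ωt × Ωt => dupHom p = 1).card := by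
  refine Finset.card_bij' (fun p _ => p * p₀⁻¹) (fun k _ => k * p₀) ?_ ?_ ?_ ?_
  · intro p hp
    simp only [Finset.mem_filter, Finset.mem_univ, true_and] at hp ⊢
    rw [map_mul, map_inv, hp, mul_inv_cancel]
  · intro k hk
    simp only [Finset.mem_filter, Finset.mem_univ, true_and] at hk ⊢
    rw [map_mul, hk, one_mul]
  · intro p _; simp
  · intro k _; simp

/-- **The counting change of variables.** Let `j : Ω → Ω̃` be an injective homomorphism of finite
abelian groups such that every `j ω` is a square in `Ω̃`. Then for every `g : Ω̃ × Ω̃ → ℝ`,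
`#(ker D) · ∑_{θ,θ'∈Ω} g(jθ, jθ') = ∑_{(φ,ψ) : φψ ∈ jΩ, φψ⁻¹ ∈ jΩ} g(φψ, φψ⁻¹)` — Ginibre's
`∫dθ dθ' = (const) ∫_{α ≡ β} dα dβ` for `θ = α−β`, `θ' = α+β` in `ℤ_p ⊂ ℤ_{2p}`, written with
`(φ,ψ) = (e^{iα}, e^{-iβ})`. [cite: Ginibre1970, §2 Example 4 (discrete change of variables, p. 316–317)] -/
theorem sum_comp_eq_sum_dupPreimage (j : Ω →* Ωt) (hj : Function.Injective j)
    (hsq : ∀ ω : Ω, ∃ s : Ωt, s * s = j ω) (g : Ωt × Ωt → ℝ) :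
    ((Finset.univ.filter fun p : Ωt × Ωt => dupHom p = 1).card : ℝ) * ∑ θ : Ω × Ω, g (j θ.1, j θ.2) =
      ∑ p ∈ (Finset.univ : Finset (Ωt × Ωt)).filter
        (fun p => (p.1 * p.2 ∈ Set.range j) ∧ (p.1 * p.2⁻¹ ∈ Set.range j)), g (dupHom p) := by
  classical
  -- the image of `Ω × Ω`
  set T : Finset (Ωt × Ωt) := Finset.univ.image (fun θ : Ω × Ω => (j θ.1, j θ.2)) with hT
  have hTmem : ∀ y : Ωt × Ωt, y ∈ T ↔ (y.1 ∈ Set.range j ∧ y.2 ∈ Set.range j) := by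
    intro y
    simp only [hT, Finset.mem_image, Finset.mem_univ, true_and, Set.mem_range]
    constructor
    · rintro ⟨θ, rfl⟩; exact ⟨⟨θ.1, rfl⟩, ⟨θ.2, rfl⟩⟩
    · rintro ⟨⟨a, ha⟩, ⟨b, hb⟩⟩; exact ⟨(a, b), Prod.ext ha hb⟩
  have hfilt : (Finset.univ : Finset (Ωt × Ωt)).filter
      (fun p => (p.1 * p.2 ∈ Set.range j) ∧ (p.1 * p.2⁻¹ ∈ Set.range j)) =
      Finset.univ.filter (fun p => dupHom p ∈ T) := by
    ext p
    simp only [Finset.mem_filter, Finset.mem_univ, true_and, hTmem, dupHom_apply]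
  rw [hfilt]
  -- sum over the preimage, fibrewise
  have hmaps : ∀ p ∈ Finset.univ.filter (fun p : Ωt × Ωt => dupHom p ∈ T), dupHom p ∈ T :=
    fun p hp => (Finset.mem_filter.1 hp).2
  rw [← Finset.sum_fiberwise_of_maps_to hmaps]
  -- every `y ∈ T` is a value of `D`, with a fibre of size `#ker D`
  have hfib : ∀ y ∈ T, ∑ p ∈ (Finset.univ.filter (fun p : Ωt × Ωt => dupHom p ∈ T)).filter
      (fun p => dupHom p = y), g (dupHom p) =
      ((Finset.univ.filter fun p : Ωt × Ωt => dupHom p = 1).card : ℝ) * g y := by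
    intro y hy
    obtain ⟨⟨hy1, hy2⟩⟩ := And.intro ((hTmem y).1 hy) trivial
    -- a preimage of `y`
    obtain ⟨a, ha⟩ := hy1
    obtain ⟨b, hb⟩ := hy2
    obtain ⟨s, hs⟩ := hsq (a * b⁻¹)
    have hab : b * (a * b⁻¹) = a := by rw [mul_left_comm, mul_inv_cancel, mul_one]
    set p₀ : Ωt × Ωt := (y.2 * s, s) with hp₀
    have hDp₀ : dupHom p₀ = y := by
      rw [hp₀, dupHom_apply]
      ext
      · change y.2 * s * s = y.1
        rw [mul_assoc, hs, ← hb, ← ha, ← map_mul, hab]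
      · change y.2 * s * s⁻¹ = y.2
        rw [mul_inv_cancel_right]
    have hset : (Finset.univ.filter (fun p : Ωt × Ωt => dupHom p ∈ T)).filter
        (fun p => dupHom p = y) = Finset.univ.filter (fun p => dupHom p = dupHom p₀) := by
      ext p
      simp only [Finset.mem_filter, Finset.mem_univ, true_and, hDp₀]
      constructor
      · rintro ⟨-, h⟩; exact h
      · intro h; exact ⟨h ▸ hy, h⟩
    rw [hset]
    rw [Finset.sum_congr rfl (fun p hp => by rw [(Finset.mem_filter.1 hp).2, hDp₀] :
      ∀ p ∈ Finset.univ.filter (fun p => dupHom p = dupHom p₀), g (dupHom p) = g y)]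
    rw [Finset.sum_const, card_filter_dupHom_eq, nsmul_eq_mul]
  rw [Finset.sum_congr rfl hfib, ← Finset.mul_sum, hT, Finset.sum_image]
  · rintro θ - θ' - h
    simp only [Prod.mk.injEq] at h
    exact Prod.ext (hj h.1) (hj h.2)

/-- Coordinatewise square-root extensions: if every `i γ` is a square in `Γ̃`, then every
configuration `i ∘ σ`, `σ : E → Γ`, is a square in `E → Γ̃` (linkwise square roots, as for
`∏ₑ ℤ_{pₑ} ⊂ ∏ₑ ℤ_{2pₑ}`). [cite: Ginibre1970, §2 Example 4 (products of cyclic groups, p. 316)] -/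
theorem exists_mul_self_eq_compLeft {E Γ Γt : Type*} [CommGroup Γ] [CommGroup Γt] (i : Γ →* Γt)
    (hsq : ∀ γ : Γ, ∃ s : Γt, s * s = i γ) (σ : E → Γ) :
    ∃ s : E → Γt, s * s = MonoidHom.compLeft i E σ :=
  ⟨fun e => Classical.choose (hsq (σ e)), funext fun e => Classical.choose_spec (hsq (σ e))⟩

end ChangeOfVariables

/-! ### 4. Ginibre's inequality through a square-root extension -/

section Main

variable {Ω : Type*} [CommGroup Ω] [Finite Ω] [TopologicalSpace Ω] [DiscreteTopology Ω]
  [MeasurableSpace Ω] [BorelSpace Ω] {Ωt : Type*} [CommGroup Ωt] [Finite Ωt] [TopologicalSpace Ωt]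
  {ι : Type*} [Fintype ι]

/-- A left-invariant measure on a finite group gives all points the same mass. [folklore] -/
private theorem measureReal_singleton_eq (μ : Measure Ω) [μ.IsMulLeftInvariant] (θ : Ω) :
    μ.real {θ} = μ.real {1} := by
  have hset : (fun h : Ω => θ⁻¹ * h) ⁻¹' ({1} : Set Ω) = {θ} := by
    ext h
    simp only [Set.mem_preimage, Set.mem_singleton_iff, inv_mul_eq_one]
    exact eq_comm
  rw [measureReal_def, measureReal_def, ← hset,
    ← Measure.map_apply (measurable_of_finite _) (MeasurableSet.singleton (1 : Ω)),
    map_mul_left_eq_self]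

/-- **Ginibre's inequality for finite abelian groups with a square-root extension** (Griffiths'
second inequality in monotone form; Ginibre 1970 §2 Example 4, the discrete case `ℤ_p`, ANY `p`).
Let `Ω` be a finite abelian group with its Haar (uniform) probability measure `μ`, `j : Ω → Ω̃` an
injective homomorphism into a finite abelian group in which every `j ω` is a square, and let the
interaction characters `χₐ` and the observed character `χ₀` of the model on `Ω` be restrictions
`χ̃ₐ ∘ j`, `χ̃₀ ∘ j` of unitary characters of `Ω̃`. Then for couplings `0 ≤ Jₐ ≤ J'ₐ` the Gibbs
expectation of `Re χ₀` for the weights `exp(∑ₐ Jₐ Re χₐ)` is non-decreasing: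
`⟨Re χ₀⟩_J ≤ ⟨Re χ₀⟩_{J'}`. For `Ω = ℤ_p^E ⊂ Ω̃ = ℤ_{2p}^E` (all characters of `ℤ_p^E` extend) this is
Ginibre's Example 4 for the finite cyclic factors, including EVEN `p` where the tree's
`ginibreExpect_reChar_mono` (every element a square) does not apply. [cite: Ginibre1970, §2 Example 4 (discrete case, p. 316–317)] -/
theorem ginibreExpect_reChar_mono_of_sqrtExt (μ : Measure Ω) [IsProbabilityMeasure μ]
    [μ.IsMulLeftInvariant] (j : Ω →* Ωt) (hj : Function.Injective j)
    (hsq : ∀ ω : Ω, ∃ s : Ωt, s * s = j ω) (χ : ι → Ω →ₜ* Circle) (χ₀ : Ω →ₜ* Circle)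
    (χt : ι → Ωt →ₜ* Circle) (χt₀ : Ωt →ₜ* Circle) (hχ : ∀ a θ, χ a θ = χt a (j θ))
    (hχ₀ : ∀ θ, χ₀ θ = χt₀ (j θ)) {J J' : ι → ℝ} (hJ : ∀ a, 0 ≤ J a) (hJJ' : ∀ a, J a ≤ J' a) :
    ginibreExpect μ χ J (reChar χ₀) ≤ ginibreExpect μ χ J' (reChar χ₀) := by
  classical
  haveI : Fintype Ω := Fintype.ofFinite Ω
  haveI : Fintype Ωt := Fintype.ofFinite Ωt
  set δ : ι → ℝ := fun a => J' a - J a with hδdef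
  have hδ : ∀ a, 0 ≤ δ a := fun a => sub_nonneg.2 (hJJ' a)
  have hγ : ∀ a, 0 ≤ δ a + 2 * J a := fun a => by have := hδ a; have := hJ a; positivity
  have hw' : ∀ θ, ginibreWeight χ J' θ = ginibreWeight χ J θ * ginibreWeight χ δ θ := fun θ => by
    rw [← ginibreWeight_add]
    congr 1
    funext a
    simp [hδdef]
  -- the one-body functions are pulled back from `Ω̃`
  have hre : ∀ θ, reChar χ₀ θ = reChar χt₀ (j θ) := fun θ => by simp only [reChar, hχ₀]
  have hwt : ∀ (K : ι → ℝ) θ, ginibreWeight χ K θ = ginibreWeight χt K (j θ) := fun K θ => by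
    simp only [ginibreWeight, ginibreHamiltonian, reChar, hχ]
  have hZ : 0 < ∫ θ, ginibreWeight χ J θ ∂μ := integral_exp_pos Integrable.of_finite
  have hZ' : 0 < ∫ θ, ginibreWeight χ J θ * ginibreWeight χ δ θ ∂μ := by
    have : (fun θ => ginibreWeight χ J θ * ginibreWeight χ δ θ) = ginibreWeight χ (J + δ) := by
      funext θ; rw [ginibreWeight_add]
    rw [this]
    exact integral_exp_pos Integrable.of_finite
  unfold ginibreExpect
  simp_rw [hw']
  rw [div_le_div_iff₀ hZ hZ']
  -- the duplicated difference (Fubini)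
  have hdup := integral_sub_mul_sub_mul μ (continuous_reChar χ₀) (continuous_ginibreWeight χ δ)
    (continuous_ginibreWeight χ J)
  -- the duplicated integrand, written on `Ω̃ × Ω̃`
  set G : Ωt × Ωt → ℝ := fun y => (reChar χt₀ y.1 - reChar χt₀ y.2) *
    (ginibreWeight χt δ y.1 - ginibreWeight χt δ y.2) *
    (ginibreWeight χt J y.1 * ginibreWeight χt J y.2) with hG
  -- Haar = uniform: the double integral is a positive multiple of the double sum
  have hm : ∀ θ : Ω, μ.real {θ} = μ.real {1} := measureReal_singleton_eq μ
  have hint : ∫ p : Ω × Ω, (reChar χ₀ p.1 - reChar χ₀ p.2) *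
        (ginibreWeight χ δ p.1 - ginibreWeight χ δ p.2) *
        (ginibreWeight χ J p.1 * ginibreWeight χ J p.2) ∂(μ.prod μ) =
      μ.real {1} ^ 2 * ∑ θ : Ω × Ω, G (j θ.1, j θ.2) := by
    rw [integral_fintype Integrable.of_finite, Finset.mul_sum]
    refine Finset.sum_congr rfl ?_
    rintro ⟨θ, θ'⟩ -
    have hμ2 : (μ.prod μ).real {(θ, θ')} = μ.real {1} ^ 2 := by
      rw [measureReal_def, ← Set.singleton_prod_singleton, Measure.prod_prod, ENNReal.toReal_mul,
        ← measureReal_def, ← measureReal_def, hm θ, hm θ', sq]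
    rw [hμ2, smul_eq_mul]
    simp only [hG, hre, hwt]
  -- the counting change of variables through the square-root extension
  have hcount := sum_comp_eq_sum_dupPreimage j hj hsq G
  -- the parity blocks: `H = {π φ = π ψ, (π φ)² = 1}` in `Ω̃ / jΩ`
  set N : Subgroup Ωt := j.range with hN
  haveI : Fintype (Ωt ⧸ N) := Fintype.ofFinite _
  have hH : (Finset.univ : Finset (Ωt × Ωt)).filter
      (fun p => p.1 * p.2 ∈ Set.range j ∧ p.1 * p.2⁻¹ ∈ Set.range j) =
      Finset.univ.filter (fun p : Ωt × Ωt => (p.1 : Ωt ⧸ N) = (p.2 : Ωt ⧸ N) ∧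
        (p.1 : Ωt ⧸ N) ∈ Finset.univ.filter fun q : Ωt ⧸ N => q * q = 1) := by
    refine Finset.filter_congr fun p _ => ?_
    have hr : ∀ x : Ωt, x ∈ Set.range j ↔ x ∈ N := fun x => by
      rw [hN, MonoidHom.mem_range, Set.mem_range]
    simp only [hr, Finset.mem_filter, Finset.mem_univ, true_and, QuotientGroup.eq_iff_div_mem,
      div_eq_mul_inv, ← QuotientGroup.mk_mul, QuotientGroup.eq_one_iff]
    constructor
    · rintro ⟨h1, h2⟩
      refine ⟨h2, ?_⟩
      have h := N.mul_mem h1 h2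
      rwa [show p.1 * p.2 * (p.1 * p.2⁻¹) = p.1 * p.1 by
        rw [mul_mul_mul_comm, mul_inv_cancel, mul_one]] at h
    · rintro ⟨h2, h1⟩
      refine ⟨?_, h2⟩
      have h := N.mul_mem h1 (N.inv_mem h2)
      rwa [show p.1 * p.1 * (p.1 * p.2⁻¹)⁻¹ = p.1 * p.2 by
        rw [mul_inv_rev, inv_inv, mul_mul_mul_comm, mul_inv_cancel, mul_one]] at h
  have hkey : ∀ p : Ωt × Ωt, G (dupHom p) = ginibreIntegrand χt χt₀ δ (fun a => δ a + 2 * J a) p :=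
    fun p => by
      simp only [hG, dupHom_apply]
      exact ginibre_key χt χt₀ J δ p.1 p.2
  have hpos : 0 ≤ ∑ p ∈ (Finset.univ : Finset (Ωt × Ωt)).filter
      (fun p => p.1 * p.2 ∈ Set.range j ∧ p.1 * p.2⁻¹ ∈ Set.range j), G (dupHom p) := by
    rw [hH, Finset.sum_congr rfl fun p _ => hkey p]
    exact sum_fibreBlocks_ginibreIntegrand_nonneg χt χt₀ hδ hγ (fun x : Ωt => (x : Ωt ⧸ N))
      (Finset.univ.filter fun q : Ωt ⧸ N => q * q = 1)
  have hsum : 0 ≤ ∑ θ : Ω × Ω, G (j θ.1, j θ.2) := by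
    rw [← hcount] at hpos
    have hc : (0 : ℝ) < ((Finset.univ.filter fun p : Ωt × Ωt => dupHom p = 1).card : ℝ) := by
      exact_mod_cast Finset.card_pos.2 ⟨1, by simp⟩
    exact (mul_nonneg_iff_of_pos_left hc).1 hpos
  have h0 : 0 ≤ 2 * ((∫ x, reChar χ₀ x * (ginibreWeight χ J x * ginibreWeight χ δ x) ∂μ) *
      (∫ x, ginibreWeight χ J x ∂μ) - (∫ x, reChar χ₀ x * ginibreWeight χ J x ∂μ) *
      (∫ x, ginibreWeight χ J x * ginibreWeight χ δ x ∂μ)) := by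
    rw [← hdup, hint]
    exact mul_nonneg (sq_nonneg _) hsum
  linarith

/-! ### 5. Griffiths' first inequality: from the second one and the free system -/

omit [Finite Ω] [TopologicalSpace Ω] [DiscreteTopology Ω] [MeasurableSpace Ω] [BorelSpace Ω] in
/-- Orthogonality of characters on a finite abelian group (the free system): `∑_θ χ(θ) = 0` for a
non-trivial unitary character `χ` (translate by `g` with `χ g ≠ 1`). [folklore] -/
private theorem sum_coe_char_eq_zero [Fintype Ω] [TopologicalSpace Ω] (χ : Ω →ₜ* Circle) {g : Ω}
    (hg : χ g ≠ 1) : ∑ θ, ((χ θ : Circle) : ℂ) = 0 := by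
  set I : ℂ := ∑ θ, ((χ θ : Circle) : ℂ) with hI
  have hinv : ((χ g : Circle) : ℂ) * I = I := by
    rw [hI, Finset.mul_sum]
    simp_rw [← Circle.coe_mul, ← map_mul]
    exact Fintype.sum_equiv (Equiv.mulLeft g) _ _ fun θ => rfl
  have hne : ((χ g : Circle) : ℂ) - 1 ≠ 0 :=
    sub_ne_zero.2 fun e => hg (Circle.ext (by rw [e, Circle.coe_one]))
  have h0 : (((χ g : Circle) : ℂ) - 1) * I = 0 := by rw [sub_mul, one_mul, hinv, sub_self]
  exact (mul_eq_zero.1 h0).resolve_left hne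

/-- **The free expectation of `Re χ` is non-negative**: for a left-invariant probability measure on
a finite abelian group, `∫ Re χ dμ = 1` if `χ` is trivial and `= 0` otherwise (orthogonality of
characters) — the `J = 0` case of Griffiths' first inequality. [cite: Ginibre1970, §2 Example 4 (Q1 for the functions cos(m·θ), p. 316)] -/
theorem integral_reChar_nonneg (μ : Measure Ω) [IsProbabilityMeasure μ] [μ.IsMulLeftInvariant]
    (χ : Ω →ₜ* Circle) : 0 ≤ ∫ θ, reChar χ θ ∂μ := by
  classical
  haveI : Fintype Ω := Fintype.ofFinite Ω
  by_cases h : ∀ g, χ g = 1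
  · have h1 : reChar χ = fun _ => 1 := funext fun θ => by simp [reChar, h θ]
    rw [h1, integral_const, smul_eq_mul, mul_one]
    exact measureReal_nonneg
  · push Not at h
    obtain ⟨g, hg⟩ := h
    rw [integral_fintype Integrable.of_finite]
    simp_rw [measureReal_singleton_eq μ, smul_eq_mul, ← Finset.mul_sum]
    refine mul_nonneg measureReal_nonneg (le_of_eq ?_)
    have hre := congrArg Complex.re (sum_coe_char_eq_zero χ hg)
    rw [Complex.re_sum, Complex.zero_re] at hre
    simpa only [reChar] using hre.symm

/-- **Griffiths' first inequality through a square-root extension**: in the setting of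
`ginibreExpect_reChar_mono_of_sqrtExt` (finite `Ω ↪ Ω̃` with square roots, characters restricted
from `Ω̃`), `0 ≤ ⟨Re χ₀⟩_J` for all couplings `Jₐ ≥ 0` — by monotonicity from the free system
`J = 0`, where `⟨Re χ₀⟩_0 = ∫ Re χ₀ dμ ∈ {0, 1}`. For `ℤ_p ⊂ ℤ_{2p}` this is Griffiths' first
inequality for clock models / `ℤ_p` gauge theories of every order `p`. [cite: Ginibre1970, §2 Example 4 (discrete case, p. 316–317) with Prop. 3] -/
theorem ginibreExpect_reChar_nonneg_of_sqrtExt (μ : Measure Ω) [IsProbabilityMeasure μ]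
    [μ.IsMulLeftInvariant] (j : Ω →* Ωt) (hj : Function.Injective j)
    (hsq : ∀ ω : Ω, ∃ s : Ωt, s * s = j ω) (χ : ι → Ω →ₜ* Circle) (χ₀ : Ω →ₜ* Circle)
    (χt : ι → Ωt →ₜ* Circle) (χt₀ : Ωt →ₜ* Circle) (hχ : ∀ a θ, χ a θ = χt a (j θ))
    (hχ₀ : ∀ θ, χ₀ θ = χt₀ (j θ)) {J : ι → ℝ} (hJ : ∀ a, 0 ≤ J a) :
    0 ≤ ginibreExpect μ χ J (reChar χ₀) := by
  have hw0 : ∀ θ, ginibreWeight χ 0 θ = 1 := fun θ => by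
    simp [ginibreWeight, ginibreHamiltonian]
  have h0 : ginibreExpect μ χ 0 (reChar χ₀) = ∫ θ, reChar χ₀ θ ∂μ := by
    unfold ginibreExpect
    simp [hw0]
  calc (0 : ℝ) ≤ ∫ θ, reChar χ₀ θ ∂μ := integral_reChar_nonneg μ χ₀
    _ = ginibreExpect μ χ 0 (reChar χ₀) := h0.symm
    _ ≤ ginibreExpect μ χ J (reChar χ₀) :=
        ginibreExpect_reChar_mono_of_sqrtExt μ j hj hsq χ χ₀ χt χt₀ hχ hχ₀ (fun _ => le_rfl) hJ

/-! ### 6. The covariance form `⟨Re χ₀⟩⟨Re χ₁⟩ ≤ ⟨Re χ₀ · Re χ₁⟩` through a square-root extension -/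

omit [Finite Ωt] in
/-- The truncations of the covariance integrand are positive kernels (`γ ≥ 0`). [folklore] -/
private theorem isPosKernel_ginibreCovTrunc' (χ : ι → Ωt →ₜ* Circle) (χ₀ χ₁ : Ωt →ₜ* Circle)
    {γ : ι → ℝ} (hγ : ∀ a, 0 ≤ γ a) (N : ℕ) : IsPosKernel (ginibreCovTrunc χ χ₀ χ₁ γ N) :=
  ((isPosKernel_mul_self (continuous_imChar χ₀)).const_mul (by norm_num : (0 : ℝ) ≤ 4)).mul
    ((isPosKernel_mul_self (continuous_imChar χ₁)).mul ((isPosKernel_reKernel χ hγ).comp_expTrunc N))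

omit [Finite Ωt] in
/-- The truncations converge to the covariance integrand. [folklore] -/
private theorem tendsto_ginibreCovTrunc' (χ : ι → Ωt →ₜ* Circle) (χ₀ χ₁ : Ωt →ₜ* Circle)
    (γ : ι → ℝ) (p : Ωt × Ωt) :
    Tendsto (fun N => ginibreCovTrunc χ χ₀ χ₁ γ N p) atTop (𝓝 (ginibreCovIntegrand χ χ₀ χ₁ γ p)) := by
  unfold ginibreCovTrunc ginibreCovIntegrand
  exact ((tendsto_expTrunc _).const_mul _).const_mul _

omit [Finite Ωt] in
/-- The covariance integrand `4 Im χ₀ Im χ₀ · Im χ₁ Im χ₁ · exp C` has a non-negative sum over every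
union of fibre blocks (`γ ≥ 0`). [cite: Ginibre1970, Prop. 3 with §2 Example 4 (discrete case, p. 317)] -/
theorem sum_fibreBlocks_ginibreCovIntegrand_nonneg [Fintype Ωt] {Q : Type*} [DecidableEq Q]
    (χ : ι → Ωt →ₜ* Circle) (χ₀ χ₁ : Ωt →ₜ* Circle) {γ : ι → ℝ} (hγ : ∀ a, 0 ≤ γ a) (π : Ωt → Q)
    (P : Finset Q) :
    0 ≤ ∑ p ∈ (Finset.univ : Finset (Ωt × Ωt)).filter (fun p => π p.1 = π p.2 ∧ π p.1 ∈ P),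
      ginibreCovIntegrand χ χ₀ χ₁ γ p := by
  set S := (Finset.univ : Finset (Ωt × Ωt)).filter (fun p => π p.1 = π p.2 ∧ π p.1 ∈ P) with hS
  have hlim : Tendsto (fun N => ∑ p ∈ S, ginibreCovTrunc χ χ₀ χ₁ γ N p) atTop
      (𝓝 (∑ p ∈ S, ginibreCovIntegrand χ χ₀ χ₁ γ p)) :=
    tendsto_finsetSum _ fun p _ => tendsto_ginibreCovTrunc' χ χ₀ χ₁ γ p
  exact ge_of_tendsto' hlim fun N =>
    sum_fibreBlocks_nonneg_of_isPosKernel (isPosKernel_ginibreCovTrunc' χ χ₀ χ₁ hγ N) π P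

/-- **Ginibre's inequality, covariance form, through a square-root extension** (Griffiths' second
inequality `⟨Re χ₀⟩_J ⟨Re χ₁⟩_J ≤ ⟨Re χ₀ · Re χ₁⟩_J` for finite abelian groups; Ginibre 1970 Prop. 3
with §2 Example 4, discrete case): in the setting of `ginibreExpect_reChar_mono_of_sqrtExt`
(finite `Ω ↪ Ω̃` with square roots, interaction and observed characters restricted from `Ω̃`,
`Jₐ ≥ 0`), every truncated two-character correlation is non-negative — for `ℤ_p` lattice gauge
theory of ANY order `p`: `⟨W_C W_{C'}⟩ ≥ ⟨W_C⟩⟨W_{C'}⟩` for all loops. (Every element a square: the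
tree's `ginibreExpect_mul_reChar_ge`.) [cite: Ginibre1970, Prop. 3 with §2 Example 4 (discrete case, p. 316–317)] -/
theorem ginibreExpect_mul_reChar_ge_of_sqrtExt (μ : Measure Ω) [IsProbabilityMeasure μ]
    [μ.IsMulLeftInvariant] (j : Ω →* Ωt) (hj : Function.Injective j)
    (hsq : ∀ ω : Ω, ∃ s : Ωt, s * s = j ω) (χ : ι → Ω →ₜ* Circle) (χ₀ χ₁ : Ω →ₜ* Circle)
    (χt : ι → Ωt →ₜ* Circle) (χt₀ χt₁ : Ωt →ₜ* Circle) (hχ : ∀ a θ, χ a θ = χt a (j θ))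
    (hχ₀ : ∀ θ, χ₀ θ = χt₀ (j θ)) (hχ₁ : ∀ θ, χ₁ θ = χt₁ (j θ)) {J : ι → ℝ} (hJ : ∀ a, 0 ≤ J a) :
    ginibreExpect μ χ J (reChar χ₀) * ginibreExpect μ χ J (reChar χ₁) ≤
      ginibreExpect μ χ J (fun θ => reChar χ₀ θ * reChar χ₁ θ) := by
  classical
  haveI : Fintype Ω := Fintype.ofFinite Ω
  haveI : Fintype Ωt := Fintype.ofFinite Ωt
  have hZ : 0 < ∫ θ, ginibreWeight χ J θ ∂μ := integral_exp_pos Integrable.of_finite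
  unfold ginibreExpect
  rw [div_mul_div_comm, div_le_div_iff₀ (mul_pos hZ hZ) hZ]
  have hdup := integral_sub_mul_sub_mul μ (continuous_reChar χ₀) (continuous_reChar χ₁)
    (continuous_ginibreWeight χ J)
  have hre₀ : ∀ θ, reChar χ₀ θ = reChar χt₀ (j θ) := fun θ => by simp only [reChar, hχ₀]
  have hre₁ : ∀ θ, reChar χ₁ θ = reChar χt₁ (j θ) := fun θ => by simp only [reChar, hχ₁]
  have hwt : ∀ (K : ι → ℝ) θ, ginibreWeight χ K θ = ginibreWeight χt K (j θ) := fun K θ => by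
    simp only [ginibreWeight, ginibreHamiltonian, reChar, hχ]
  set G : Ωt × Ωt → ℝ := fun y => (reChar χt₀ y.1 - reChar χt₀ y.2) *
    (reChar χt₁ y.1 - reChar χt₁ y.2) * (ginibreWeight χt J y.1 * ginibreWeight χt J y.2) with hG
  have hm : ∀ θ : Ω, μ.real {θ} = μ.real {1} := measureReal_singleton_eq μ
  have hint : ∫ p : Ω × Ω, (reChar χ₀ p.1 - reChar χ₀ p.2) * (reChar χ₁ p.1 - reChar χ₁ p.2) *
        (ginibreWeight χ J p.1 * ginibreWeight χ J p.2) ∂(μ.prod μ) =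
      μ.real {1} ^ 2 * ∑ θ : Ω × Ω, G (j θ.1, j θ.2) := by
    rw [integral_fintype Integrable.of_finite, Finset.mul_sum]
    refine Finset.sum_congr rfl ?_
    rintro ⟨θ, θ'⟩ -
    have hμ2 : (μ.prod μ).real {(θ, θ')} = μ.real {1} ^ 2 := by
      rw [measureReal_def, ← Set.singleton_prod_singleton, Measure.prod_prod, ENNReal.toReal_mul,
        ← measureReal_def, ← measureReal_def, hm θ, hm θ', sq]
    rw [hμ2, smul_eq_mul]
    simp only [hG, hre₀, hre₁, hwt]
  have hcount := sum_comp_eq_sum_dupPreimage j hj hsq G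
  set N : Subgroup Ωt := j.range with hN
  haveI : Fintype (Ωt ⧸ N) := Fintype.ofFinite _
  have hH : (Finset.univ : Finset (Ωt × Ωt)).filter
      (fun p => p.1 * p.2 ∈ Set.range j ∧ p.1 * p.2⁻¹ ∈ Set.range j) =
      Finset.univ.filter (fun p : Ωt × Ωt => (p.1 : Ωt ⧸ N) = (p.2 : Ωt ⧸ N) ∧
        (p.1 : Ωt ⧸ N) ∈ Finset.univ.filter fun q : Ωt ⧸ N => q * q = 1) := by
    refine Finset.filter_congr fun p _ => ?_
    have hr : ∀ x : Ωt, x ∈ Set.range j ↔ x ∈ N := fun x => by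
      rw [hN, MonoidHom.mem_range, Set.mem_range]
    simp only [hr, Finset.mem_filter, Finset.mem_univ, true_and, QuotientGroup.eq_iff_div_mem,
      div_eq_mul_inv, ← QuotientGroup.mk_mul, QuotientGroup.eq_one_iff]
    constructor
    · rintro ⟨h1, h2⟩
      refine ⟨h2, ?_⟩
      have h := N.mul_mem h1 h2
      rwa [show p.1 * p.2 * (p.1 * p.2⁻¹) = p.1 * p.1 by
        rw [mul_mul_mul_comm, mul_inv_cancel, mul_one]] at h
    · rintro ⟨h2, h1⟩
      refine ⟨?_, h2⟩
      have h := N.mul_mem h1 (N.inv_mem h2)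
      rwa [show p.1 * p.1 * (p.1 * p.2⁻¹)⁻¹ = p.1 * p.2 by
        rw [mul_inv_rev, inv_inv, mul_mul_mul_comm, mul_inv_cancel, mul_one]] at h
  have hkey : ∀ p : Ωt × Ωt, G (dupHom p) = ginibreCovIntegrand χt χt₀ χt₁ (fun a => 2 * J a) p :=
    fun p => by
      simp only [hG, dupHom_apply]
      exact ginibre_cov_key χt χt₀ χt₁ J p.1 p.2
  have hpos : 0 ≤ ∑ p ∈ (Finset.univ : Finset (Ωt × Ωt)).filter
      (fun p => p.1 * p.2 ∈ Set.range j ∧ p.1 * p.2⁻¹ ∈ Set.range j), G (dupHom p) := by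
    rw [hH, Finset.sum_congr rfl fun p _ => hkey p]
    exact sum_fibreBlocks_ginibreCovIntegrand_nonneg χt χt₀ χt₁ (γ := fun a => 2 * J a)
      (fun a => by have := hJ a; positivity) (fun x : Ωt => (x : Ωt ⧸ N))
      (Finset.univ.filter fun q : Ωt ⧸ N => q * q = 1)
  have hsum : 0 ≤ ∑ θ : Ω × Ω, G (j θ.1, j θ.2) := by
    rw [← hcount] at hpos
    have hc : (0 : ℝ) < ((Finset.univ.filter fun p : Ωt × Ωt => dupHom p = 1).card : ℝ) := by
      exact_mod_cast Finset.card_pos.2 ⟨1, by simp⟩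
    exact (mul_nonneg_iff_of_pos_left hc).1 hpos
  have h0 : 0 ≤ 2 * ((∫ x, reChar χ₀ x * (ginibreWeight χ J x * reChar χ₁ x) ∂μ) *
      (∫ x, ginibreWeight χ J x ∂μ) - (∫ x, reChar χ₀ x * ginibreWeight χ J x ∂μ) *
      (∫ x, ginibreWeight χ J x * reChar χ₁ x ∂μ)) := by
    rw [← hdup, hint]
    exact mul_nonneg (sq_nonneg _) hsum
  have e1 : ∫ x, reChar χ₀ x * (ginibreWeight χ J x * reChar χ₁ x) ∂μ =
      ∫ x, reChar χ₀ x * reChar χ₁ x * ginibreWeight χ J x ∂μ :=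
    integral_congr_ae (ae_of_all _ fun x => by ring)
  have e2 : ∫ x, ginibreWeight χ J x * reChar χ₁ x ∂μ = ∫ x, reChar χ₁ x * ginibreWeight χ J x ∂μ :=
    integral_congr_ae (ae_of_all _ fun x => by ring)
  rw [e1, e2] at h0
  nlinarith [h0]

end Main

end GinibreSqrtExt

end Literature.Probability.LatticeModels

end
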